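import Literature.Probability.Percolation.TriLatticeCells
import Literature.Probability.RandomPlanarGeometry.HexSAWLattice
import HarnessLib

/-!
# Crux `BoundaryClosureR` (stmt-CriticalPhenomena-14004), line `polygon-parity-squeeze`,
# stub `stub_innerPolygons` (IP): the left-hand boundary walk of a pinch-free finite set of
# triangles of `𝕋` is a periodic, VERTEX-SIMPLE cycle of boundary darts

Landing target:
`Summits/CriticalPhenomena/SAWScalingLimit/Theorems/SAWDefectDecoherenceBoundaryClosureRInnerPolygonsBoundaryWalk.lean`
(`--supports stmt-CriticalPhenomena-14004`; building block of the registered stub `stub_innerPolygons`,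
hypothesis (IP) of the landed squeeze `PolygonParitySqueeze.squeeze_of_innerPolygons`: the inner exact
polygon `P` is the inside of the boundary cycle of a pinch-free union `K` of triangles of a coarse
triangular grid — super-hexagon tiles deep inside `Ω` plus two grid trapezoids on the flat pins).

DEFINITIONS (DATA only; combinatorics of the triangular lattice `𝕋 = triEmbed (Site 2)`, faces =
`HexVertex`):
* `faceL x k` — the LEFT face of the dart `x → x + triDir k`, the triangle
  `{x, x + triDir k, x + triDir (k+1)}` (`hexFaceVertices_faceL`); `faceL x 0, …, faceL x 5` are the
  six faces round `x`, anticlockwise (`mem_hexFaceVertices_iff`); seen from the head the left face is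
  `faceL y (k+2)` and the right face `faceL x (k+5)` is `faceL y (k+3)` (`faceL_head`);
* `bdDarts K : Finset (Site 2 × Fin 6)` — the boundary darts of the triangle set
  `K : Finset HexVertex`: left face in `K`, right face not (`mem_bdDarts`; these are the boundary
  mid-edges `hexDomainBoundary K`, oriented with `K` on the left);
* `bsucc K` — the LEFT-HAND SUCCESSOR: from the head, the first boundary dart in the order sharp
  left `k+2`, left `k+1`, straight `k`, right `k+5`, sharp right `k+4`; `bpred K` — its inverse, read
  off the anticlockwise extent of the `K`-fan at the head; `bwalk K d₀ n = (bsucc K)^[n] d₀`.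
NO PINCH is the hypothesis `∀ y, #{k | faceL y k ∈ K ∧ faceL y (k+1) ∉ K} ≤ 1` (round every vertex
at most one anticlockwise `K → non-K` switch, i.e. the `K`-faces at a vertex form a contiguous fan;
automatic for unions of tiles of a 3-valent tiling), carried explicitly.

RESULTS: `isBdDart_bsucc` (the successor is a boundary dart at the head), `bpred_bsucc`
(`bpred ∘ bsucc = id` on boundary darts, so `bsucc_injOn`), `exists_bwalk_period` and
`exists_minimal_period` (the walk is periodic), `card_bdDart_le_one` (no pinch ⇒ at most ONE
outgoing boundary dart per vertex, a `decide`d fact about `6`-cycles), whence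
**`bwalk_fst_injOn` / `boundaryWalk_vertexSimple`: within a minimal period the walk visits pairwise
distinct vertices** — vertex-simplicity for free, no winding numbers (contrast
`Literature/Probability/LatticeModels/DiscreteFaceBoundary.lean`, the square-lattice template, where
pinches are excluded by a winding-number argument).  The sequel `…InnerPolygonsBoundaryPolygon.lean`
turns the cycle into an `IsSimpleClosedPolygon`.

Sources: folklore lattice combinatorics; B. Bollobás, O. Riordan, *Percolation* (2006) Ch. 7 §7.2.2
(boundary traversal of discrete domains of `𝕋`); the tree's `TriDiscShelling.triDir`,
`TriangularLattice.hexFaceVertices`.  No proposition is defined and no named fact is introduced.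
-/

noncomputable section

open scoped Classical
open Literature.Probability.LatticeModels
open Literature.Probability.Percolation (triDir)
open Literature.Probability.RandomPlanarGeometry.SAW (site_two_eq_iff)

namespace Summit.CriticalPhenomena.SAWScalingLimit.Theorems.PolygonParitySqueeze.BoundaryWalk

/-- The LEFT face of the dart `x → x + triDir k`: the triangle `{x, x + triDir k, x + triDir (k+1)}`.
[folklore] -/
def faceL (x : Site 2) (k : Fin 6) : HexVertex :=
  ![((x, 0) : HexVertex), (x - Pi.single 0 1, 1), (x - Pi.single 0 1, 0),
    (x - Pi.single 0 1 - Pi.single 1 1, 1), (x - Pi.single 1 1, 0), (x - Pi.single 1 1, 1)] k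

/-- The vertices of the left face are `x, x + triDir k, x + triDir (k+1)` (PROVED: the table
`faceL` is right). [folklore] -/
theorem hexFaceVertices_faceL (x : Site 2) (k : Fin 6) :
    hexFaceVertices (faceL x k) = {x, x + triDir k, x + triDir (k + 1)} := by
  ext v
  fin_cases k <;>
    simp [faceL, hexFaceVertices, triDir, site_two_eq_iff] <;> omega

/-- Seen from the head `y = x + triDir k`, the left face of `x → y` spans `[k+2, k+3]` and the right
face `faceL x (k+5)` spans `[k+3, k+4]` (PROVED). [folklore] -/
theorem faceL_head (x : Site 2) (k : Fin 6) :
    faceL (x + triDir k) (k + 2) = faceL x k ∧ faceL (x + triDir k) (k + 3) = faceL x (k + 5) := by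
  fin_cases k <;> simp [faceL, triDir, Prod.ext_iff, site_two_eq_iff] <;> omega

/-- The six faces round `x` are exactly the faces having `x` as a vertex (PROVED). [folklore] -/
theorem mem_hexFaceVertices_iff (x : Site 2) (F : HexVertex) :
    x ∈ hexFaceVertices F ↔ ∃ k : Fin 6, F = faceL x k := by
  constructor
  · intro hx
    obtain ⟨c, t⟩ := F
    fin_cases t
    · simp [hexFaceVertices] at hx
      rcases hx with rfl | rfl | rfl
      · exact ⟨0, by simp [faceL]⟩
      · exact ⟨2, by simp [faceL]⟩
      · exact ⟨4, by simp [faceL]⟩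
    · simp [hexFaceVertices] at hx
      rcases hx with rfl | rfl | rfl
      · exact ⟨1, by simp [faceL]⟩
      · exact ⟨5, by simp [faceL]⟩
      · exact ⟨3, by simp [faceL, sub_sub]⟩
  · rintro ⟨k, rfl⟩
    rw [hexFaceVertices_faceL]
    simp

/-- The source of a dart is recovered from its left face and its direction. [folklore] -/
theorem faceL_fst_add (x : Site 2) (k : Fin 6) :
    (faceL x k).1 + ![0, Pi.single 0 1, Pi.single 0 1, Pi.single 0 1 + Pi.single 1 1,
      Pi.single 1 1, Pi.single 1 1] k = x := by
  fin_cases k <;> simp [faceL]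

/-- **The boundary darts** of the triangle set `K` (a `Finset`: each is determined by its left face,
which lies in `K`, and its direction): the darts `(x, k)`, i.e. `x → x + triDir k`, whose LEFT face
`faceL x k` is in `K` and whose RIGHT face `faceL x (k+5)` is not. [folklore] -/
def bdDarts (K : Finset HexVertex) : Finset (Site 2 × Fin 6) :=
  ((K ×ˢ (Finset.univ : Finset (Fin 6))).image fun q : HexVertex × Fin 6 =>
      (q.1.1 + ![0, Pi.single 0 1, Pi.single 0 1, Pi.single 0 1 + Pi.single 1 1,
        Pi.single 1 1, Pi.single 1 1] q.2, q.2)).filter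
    fun p => faceL p.1 p.2 ∈ K ∧ faceL p.1 (p.2 + 5) ∉ K

/-- Membership in the boundary darts: left face in `K`, right face not. [folklore] -/
theorem mem_bdDarts {K : Finset HexVertex} {p : Site 2 × Fin 6} :
    p ∈ bdDarts K ↔ faceL p.1 p.2 ∈ K ∧ faceL p.1 (p.2 + 5) ∉ K := by
  constructor
  · intro h
    exact (Finset.mem_filter.1 h).2
  · intro h
    refine Finset.mem_filter.2 ⟨Finset.mem_image.2 ⟨(faceL p.1 p.2, p.2),
      Finset.mem_product.2 ⟨h.1, Finset.mem_univ _⟩, ?_⟩, h⟩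
    obtain ⟨x, k⟩ := p
    simp only [faceL_fst_add]

/-- **Left-hand successor**: from the head `y` of `(x, k)`, the first boundary dart in the order
sharp left (`k+2`), left (`k+1`), straight (`k`), right (`k+5`), sharp right (`k+4`). [folklore] -/
def bsucc (K : Finset HexVertex) (p : Site 2 × Fin 6) : Site 2 × Fin 6 :=
  let y := p.1 + triDir p.2
  if faceL y (p.2 + 1) ∉ K then (y, p.2 + 2)
  else if faceL y p.2 ∉ K then (y, p.2 + 1)
  else if faceL y (p.2 + 5) ∉ K then (y, p.2)
  else if faceL y (p.2 + 4) ∉ K then (y, p.2 + 5)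
  else (y, p.2 + 4)

variable {K : Finset HexVertex}

/-- `Fin 6` bookkeeping for the successor. [folklore] -/
theorem fin6_add_two_add_five (k : Fin 6) : k + 2 + 5 = k + 1 := by revert k; decide
/-- `Fin 6` bookkeeping for the successor. [folklore] -/
theorem fin6_add_one_add_five (k : Fin 6) : k + 1 + 5 = k := by revert k; decide
/-- `Fin 6` bookkeeping for the successor. [folklore] -/
theorem fin6_add_five_add_five (k : Fin 6) : k + 5 + 5 = k + 4 := by revert k; decide
/-- `Fin 6` bookkeeping for the successor. [folklore] -/
theorem fin6_add_four_add_five (k : Fin 6) : k + 4 + 5 = k + 3 := by revert k; decide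

/-- The successor of a boundary dart is a boundary dart sourced at its head (PROVED: the successor
convention is consistent with `faceL_head`). [folklore] -/
theorem isBdDart_bsucc {p : Site 2 × Fin 6} (hp : p ∈ bdDarts K) :
    bsucc K p ∈ bdDarts K ∧ (bsucc K p).1 = p.1 + triDir p.2 := by
  obtain ⟨x, k⟩ := p
  obtain ⟨hL, hR⟩ := mem_bdDarts.1 hp
  obtain ⟨h2, h3⟩ := faceL_head x k
  simp only at hL hR h2 h3 ⊢
  unfold bsucc
  dsimp only
  split_ifs with h1 h0 h5 h4
  · -- all four of `k+1, k, k+5, k+4` are in `K`: sharp right `(y, k+4)`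
    refine ⟨mem_bdDarts.2 ⟨h4, ?_⟩, rfl⟩
    show faceL (x + triDir k) (k + 4 + 5) ∉ K
    rw [fin6_add_four_add_five, h3]; exact hR
  · refine ⟨mem_bdDarts.2 ⟨h5, ?_⟩, rfl⟩
    show faceL (x + triDir k) (k + 5 + 5) ∉ K
    rw [fin6_add_five_add_five]; exact h4
  · exact ⟨mem_bdDarts.2 ⟨h0, h5⟩, rfl⟩
  · refine ⟨mem_bdDarts.2 ⟨h1, ?_⟩, rfl⟩
    show faceL (x + triDir k) (k + 1 + 5) ∉ K
    rw [fin6_add_one_add_five]; exact h0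
  · refine ⟨mem_bdDarts.2 ⟨?_, ?_⟩, rfl⟩
    · show faceL (x + triDir k) (k + 2) ∈ K
      rw [h2]; exact hL
    · show faceL (x + triDir k) (k + 2 + 5) ∉ K
      rw [fin6_add_two_add_five]; exact h1

/-- **Left-hand predecessor** of the boundary dart `(y, j)`: read off the anticlockwise extent `m`
of the `K`-fan at `y` starting from `faceL y j` (`faceL y (j+1), …, faceL y (j+m) ∈ K`,
`faceL y (j+m+1) ∉ K`); the incoming dart has direction `j + m + 4` and source
`y + triDir (j + m + 1)`. [folklore] -/
def bpred (K : Finset HexVertex) (q : Site 2 × Fin 6) : Site 2 × Fin 6 :=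
  if faceL q.1 (q.2 + 1) ∉ K then (q.1 + triDir (q.2 + 1), q.2 + 4)
  else if faceL q.1 (q.2 + 2) ∉ K then (q.1 + triDir (q.2 + 2), q.2 + 5)
  else if faceL q.1 (q.2 + 3) ∉ K then (q.1 + triDir (q.2 + 3), q.2)
  else if faceL q.1 (q.2 + 4) ∉ K then (q.1 + triDir (q.2 + 4), q.2 + 1)
  else (q.1 + triDir (q.2 + 5), q.2 + 2)

/-- Opposite directions cancel. [folklore] -/
theorem triDir_add_triDir_add_three (k : Fin 6) : triDir k + triDir (k + 3) = 0 := by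
  fin_cases k <;> simp [triDir]

/-- `x + triDir k + triDir (k + 3) = x`. [folklore] -/
theorem add_triDir_add_triDir_add_three (x : Site 2) (k : Fin 6) : x + triDir k + triDir (k + 3) = x := by
  rw [add_assoc, triDir_add_triDir_add_three, add_zero]

/-- **`bpred ∘ bsucc = id` on boundary darts** (PROVED). [folklore] -/
theorem bpred_bsucc {p : Site 2 × Fin 6} (hp : p ∈ bdDarts K) : bpred K (bsucc K p) = p := by
  obtain ⟨x, k⟩ := p
  obtain ⟨hL, hR⟩ := mem_bdDarts.1 hp
  obtain ⟨h2, h3⟩ := faceL_head x k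
  simp only at hL hR h2 h3
  have hx : x + triDir k + triDir (k + 3) = x := add_triDir_add_triDir_add_three x k
  have e21 : k + 2 + 1 = k + 3 := by rw [add_assoc]; rfl
  have e24 : k + 2 + 4 = k := by rw [add_assoc, show (2 : Fin 6) + 4 = 0 from by decide, add_zero]
  have e11 : k + 1 + 1 = k + 2 := by rw [add_assoc]; rfl
  have e12 : k + 1 + 2 = k + 3 := by rw [add_assoc]; rfl
  have e15 : k + 1 + 5 = k := by rw [add_assoc, show (1 : Fin 6) + 5 = 0 from by decide, add_zero]
  have e51 : k + 5 + 1 = k := by rw [add_assoc, show (5 : Fin 6) + 1 = 0 from by decide, add_zero]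
  have e52 : k + 5 + 2 = k + 1 := by rw [add_assoc, show (5 : Fin 6) + 2 = 1 from by decide]
  have e53 : k + 5 + 3 = k + 2 := by rw [add_assoc, show (5 : Fin 6) + 3 = 2 from by decide]
  have e54 : k + 5 + 4 = k + 3 := by rw [add_assoc, show (5 : Fin 6) + 4 = 3 from by decide]
  have e41 : k + 4 + 1 = k + 5 := by rw [add_assoc]; rfl
  have e42 : k + 4 + 2 = k := by rw [add_assoc, show (4 : Fin 6) + 2 = 0 from by decide, add_zero]
  have e43 : k + 4 + 3 = k + 1 := by rw [add_assoc, show (4 : Fin 6) + 3 = 1 from by decide]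
  have e44 : k + 4 + 4 = k + 2 := by rw [add_assoc, show (4 : Fin 6) + 4 = 2 from by decide]
  have e45 : k + 4 + 5 = k + 3 := by rw [add_assoc, show (4 : Fin 6) + 5 = 3 from by decide]
  have hK2 : faceL (x + triDir k) (k + 2) ∈ K := by rw [h2]; exact hL
  have hK3 : faceL (x + triDir k) (k + 3) ∉ K := by rw [h3]; exact hR
  unfold bsucc
  dsimp only
  split_ifs with h1 h0 h5 h4
  · -- sharp right: `j = k + 4`
    unfold bpred; dsimp only
    rw [e41, e42, e43, e44, e45, if_neg (not_not.2 h5), if_neg (not_not.2 h0), if_neg (not_not.2 h1),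
      if_neg (not_not.2 hK2), hx]
  · -- right: `j = k + 5`
    unfold bpred; dsimp only
    rw [e51, e52, e53, e54, if_neg (not_not.2 h0), if_neg (not_not.2 h1), if_neg (not_not.2 hK2), if_pos hK3, hx]
  · -- straight: `j = k`
    unfold bpred; dsimp only
    rw [if_neg (not_not.2 h1), if_neg (not_not.2 hK2), if_pos hK3, hx]
  · -- left: `j = k + 1`
    unfold bpred; dsimp only
    rw [e11, e12, e15, if_neg (not_not.2 hK2), if_pos hK3, hx]
  · -- sharp left: `j = k + 2`
    unfold bpred; dsimp only
    rw [e21, e24, if_pos hK3, hx]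

/-- `bsucc` is injective on boundary darts (it has the left-hand predecessor as left inverse)
(PROVED). [folklore] -/
theorem bsucc_injOn : Set.InjOn (bsucc K) ↑(bdDarts K) := by
  intro p hp p' hp' h
  rw [← bpred_bsucc hp, ← bpred_bsucc hp', h]

/-- The boundary walk from `d₀`. [folklore] -/
def bwalk (K : Finset HexVertex) (d₀ : Site 2 × Fin 6) (n : ℕ) : Site 2 × Fin 6 := (bsucc K)^[n] d₀

/-- One step of the walk. [folklore] -/
theorem bwalk_succ (d₀ : Site 2 × Fin 6) (n : ℕ) :
    bwalk K d₀ (n + 1) = bsucc K (bwalk K d₀ n) :=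
  Function.iterate_succ_apply' _ _ _

/-- The walk stays on boundary darts. [folklore] -/
theorem isBdDart_bwalk {d₀ : Site 2 × Fin 6} (h₀ : d₀ ∈ bdDarts K) (n : ℕ) :
    bwalk K d₀ n ∈ bdDarts K := by
  induction n with
  | zero => exact h₀
  | succ n ih => rw [bwalk_succ]; exact (isBdDart_bsucc ih).1

/-- Cancelling equal tails of the walk (dart-injectivity of `bsucc`). [folklore] -/
theorem bwalk_eq_of_add_eq {d₀ : Site 2 × Fin 6} (h₀ : d₀ ∈ bdDarts K) {i j : ℕ} (d : ℕ)
    (h : bwalk K d₀ (i + d) = bwalk K d₀ (j + d)) :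
    bwalk K d₀ i = bwalk K d₀ j := by
  induction d with
  | zero => exact h
  | succ d ih =>
    apply ih
    rw [← add_assoc, ← add_assoc, bwalk_succ, bwalk_succ] at h
    exact bsucc_injOn (isBdDart_bwalk h₀ _) (isBdDart_bwalk h₀ _) h

/-- **Periodicity**: the walk from a boundary dart returns to it (finitely many darts, injective
step) (PROVED). [folklore] -/
theorem exists_bwalk_period {d₀ : Site 2 × Fin 6} (h₀ : d₀ ∈ bdDarts K) :
    ∃ P, 0 < P ∧ bwalk K d₀ P = d₀ := by
  obtain ⟨i, j, hij, h⟩ := (bdDarts K).finite_toSet.exists_lt_map_eq_of_forall_mem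
    (f := bwalk K d₀) (fun n => Finset.mem_coe.2 (isBdDart_bwalk h₀ n))
  refine ⟨j - i, by omega, ?_⟩
  have := bwalk_eq_of_add_eq h₀ (i := 0) (j := j - i) i
    (by rw [zero_add, Nat.sub_add_cancel hij.le]; exact h)
  exact this.symm

/-- Round a `6`-cycle, at most one `true → false` switch forces at most one `false → true` switch
(read at `k+5 → k`). [folklore] -/
theorem card_up_le_one_of_card_down_le_one (f : Fin 6 → Bool)
    (h : (Finset.univ.filter fun k : Fin 6 => f k = true ∧ f (k + 1) = false).card ≤ 1) :
    (Finset.univ.filter fun k : Fin 6 => f k = true ∧ f (k + 5) = false).card ≤ 1 := by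
  revert f
  decide

/-- **Under no pinch every vertex carries at most one outgoing boundary dart** (PROVED). [folklore] -/
theorem card_bdDart_le_one (hK : ∀ y : Site 2, (Finset.univ.filter fun k : Fin 6 => faceL y k ∈ K ∧ faceL y (k + 1) ∉ K).card ≤ 1) (y : Site 2) :
    (Finset.univ.filter fun k : Fin 6 => (y, k) ∈ bdDarts K).card ≤ 1 := by
  have h := card_up_le_one_of_card_down_le_one (fun k => decide (faceL y k ∈ K)) (by
    convert hK y using 2
    ext k
    simp)
  convert h using 2
  ext k
  simp [mem_bdDarts]

/-- **Vertex-simplicity for free**: within a period the walk visits pairwise distinct vertices (two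
visits of `y` would be two distinct boundary darts out of `y`). [folklore] -/
theorem bwalk_fst_injOn (hK : ∀ y : Site 2, (Finset.univ.filter fun k : Fin 6 => faceL y k ∈ K ∧ faceL y (k + 1) ∉ K).card ≤ 1) {d₀ : Site 2 × Fin 6} (h₀ : d₀ ∈ bdDarts K) {P : ℕ}
    (hmin : ∀ m, 0 < m → m < P → bwalk K d₀ m ≠ d₀)
    {s t : ℕ} (hs : s < P) (ht : t < P) (h : (bwalk K d₀ s).1 = (bwalk K d₀ t).1) :
    s = t := by
  -- the two darts are boundary darts out of the same vertex, hence equal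
  have hds := isBdDart_bwalk h₀ s
  have hdt := isBdDart_bwalk h₀ t
  have heq : bwalk K d₀ s = bwalk K d₀ t := by
    have hcard := card_bdDart_le_one hK (bwalk K d₀ s).1
    have h2 : (bwalk K d₀ s).2 = (bwalk K d₀ t).2 := by
      refine Finset.card_le_one.1 hcard _ ?_ _ ?_
      · simp only [Finset.mem_filter, Finset.mem_univ, true_and, Prod.mk.eta]; exact hds
      · simp only [Finset.mem_filter, Finset.mem_univ, true_and, h, Prod.mk.eta]; exact hdt
    exact Prod.ext h h2
  -- equal darts within a minimal period have equal indices
  by_contra hst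
  wlog hlt : s < t generalizing s t
  · exact this ht hs h.symm hdt hds heq.symm (Ne.symm hst) (lt_of_le_of_ne (not_lt.1 hlt) (Ne.symm hst))
  have key := bwalk_eq_of_add_eq h₀ (i := 0) (j := t - s) s
    (by rw [zero_add, Nat.sub_add_cancel hlt.le]; exact heq)
  exact hmin (t - s) (by omega) (by omega) key.symm

/-- **A minimal period exists** (PROVED): the first return time of the walk to `d₀`. [folklore] -/
theorem exists_minimal_period {d₀ : Site 2 × Fin 6} (h₀ : d₀ ∈ bdDarts K) :
    ∃ P, 0 < P ∧ bwalk K d₀ P = d₀ ∧ ∀ m, 0 < m → m < P → bwalk K d₀ m ≠ d₀ := by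
  classical
  have hex := exists_bwalk_period h₀
  refine ⟨Nat.find hex, (Nat.find_spec hex).1, (Nat.find_spec hex).2, fun m hm hmP h => ?_⟩
  exact Nat.find_min hex hmP ⟨hm, h⟩

/-- **Vertex-simple boundary cycle** (registered form, sub-goal of `stub_innerPolygons`): for a
pinch-free finite triangle set and a boundary dart `d₀`, the left-hand boundary walk from `d₀` has a
minimal period `P > 0` within which it visits pairwise distinct vertices. [folklore] -/
theorem boundaryWalk_vertexSimple : ∀ (K : Finset HexVertex), (∀ y : Site 2, (Finset.univ.filter fun k : Fin 6 => faceL y k ∈ K ∧ faceL y (k + 1) ∉ K).card ≤ 1) → ∀ (d₀ : Site 2 × Fin 6), d₀ ∈ bdDarts K → ∃ P : ℕ, 0 < P ∧ bwalk K d₀ P = d₀ ∧ (∀ m : ℕ, 0 < m → m < P → bwalk K d₀ m ≠ d₀) ∧ ∀ s t : ℕ, s < P → t < P → (bwalk K d₀ s).1 = (bwalk K d₀ t).1 → s = t := by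
  intro K hK d₀ h₀
  obtain ⟨P, hP, hPd, hmin⟩ := exists_minimal_period h₀
  exact ⟨P, hP, hPd, hmin, fun s t hs ht h => bwalk_fst_injOn hK h₀ hmin hs ht h⟩

end Summit.CriticalPhenomena.SAWScalingLimit.Theorems.PolygonParitySqueeze.BoundaryWalk

end
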